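/-
Copyright (c) 2026 the pub-hodgecm-mathlib formalisation cell (harness21).  Prover seat hodgecm-mathlib-LH4-p13 (g0): Track A «(D-RAM) FOUR-FRAME» squad of crux H413
(dealer LH4-plan (g10) WORD #29 «p13 → (e) `stub_U2H_typeTwoRow_wild`»), 2026-09-03.
-/
import Literature.Combinatorics.SimpleGraph.TreeAutomorphismFixedSubtree                   -- (this seat): `#fixed edges + 1 = #fixed vertices` for a colour-preserving tree endomorphism with a fixed vertex
import Literature.NumberTheory.Automorphic.SLTwoTreeAsLatticeTree                         -- ★ (F0P3a-p04): `isTree_latticeTree_id_altJ` (the tree of `SL₂(F)`)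
import Literature.NumberTheory.Automorphic.SLTwoTreeProjectiveActionIso                     -- ★ (B-p08): `latticeTree_adj_glVertexAct` (`GL₂(F)` acts by graph maps)
import Literature.NumberTheory.Automorphic.SLTwoTreeQuadraticTorusShellCount                -- ★ (A-p17): `glVertexAct_injective`
import Literature.NumberTheory.Automorphic.SLTwoTreeEllipticFixedBallTorusForm             -- ★ p855257 (this seat): the vertex balls of regular elliptic elements in torus form (inert ∕ Eisenstein, dyadic-safe)
import Literature.NumberTheory.Automorphic.UnitaryTwoRamifiedFixedSelfDualEdgesPiType       -- ★ p855331 (this seat): √π `K₂` ↔ edges; brings ★ p855177 (√u `K₂` ↔ vertices)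
import Literature.NumberTheory.Automorphic.UnitaryTwoRamifiedFixedModularEdgesUnitType      -- ★ p855231 (this seat): √u `K♯` ↔ edges; brings ★ `natCard_fixedBy_eq_ncard_fixedBy_onePlace`, ★ p847070 (√π `K♯` ↔ vertices)
import HarnessLib

/-!
# The fixed subtree on the tree of `SL₂(F)`: for `g ∈ GL₂(F)` fixing a vertex, `#{set-wise fixed edges} + 1 = #{fixed vertices}`; hence on `U(Φ₂)(L⁺_v)`
# at ANY ramified place `#Fix_{γ₂}(U₂ ⧸ K_edge) + 1 = #Fix_{γ₂}(U₂ ⧸ K_vertex)` — √π: `(K₂, K♯)`, √u: `(K♯, K₂)` — WITHOUT `|2|_w = 1` (Kottwitz 1988 §2; Serre, *Trees* I §6.1)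

Topic `NumberTheory/Automorphic`; namespaces `Literature.NumberTheory.Automorphic.HermitianLatticeTree` (§1, the tree of `SL₂(F)`) and `…Automorphic.UnitaryGroup` (§2, the CM
carrier).  THEOREMS ONLY (no definition, no instance, no notation, no named fact, no `sorry`); kernel lane `--supports stmt-HodgeConjecture-24833`.  Cell `pub/hodgecm-mathlib`
(D-0151), crux H413; Track A «(D-RAM) FOUR-FRAME», unit U2H (ii-H), child (e) `stub_U2H_typeTwoRow_wild` (dealer LH4-plan (g10) WORD #29; LH4-p06 (g0) ED. 6 (ρ) ∕ (e₀)):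
the WILD replacement of the tame ★ `natCard_fixedBy_add_one_eq_natCard_fixedBy_of_deep_of_ramified` (`#Fix(U₂⧸K⁰) + 1 = #Fix(U₂⧸K♯)`, binder `h2`), in descent-representative
form.  HONEST LABEL: HC_CM is proved only modulo the 7 printed citations (2 remaining named inputs: hLiu418 = stmt-HodgeConjecture-24832, h413 = stmt-HodgeConjecture-24833) until
rung 0 closes; nothing printed is asserted here.

THE MATHEMATICS.  On the tree `X` of `SL₂(F)` (★ `isTree_latticeTree_id_altJ`; vertices the self-dual and `ϖ`-modular special lattices, a PROPER 2-colouring ★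
`not_isModularLattice_of_isSelfDualLattice` ∕ `latticeTree_adj_iff`, §1) any `g ∈ GL₂(F)` acts by an injective graph endomorphism (★ `latticeTree_adj_glVertexAct`,
★ `glVertexAct_injective`); if it fixes a vertex `x₀` it preserves the bipartition (walk-length parity from `x₀`), hence inverts no edge, its fixed vertices induce a subtree,
and when they are finitely many the generic fixed-subtree count (this seat, `Combinatorics/SimpleGraph/TreeAutomorphismFixedSubtree`, head `…_of_isTree`) gives
`#{e | g·e = e set-wise} + 1 = #{x | g·x = x}` (§1) — no determinant ∕ type hypothesis.  At a ramified
CM place the two counts are the `K_edge`- and `K_vertex`-coset counts of `γ₂ ∈ U₂ = U(Φ₂)(L⁺_v)` for any descent representative `g` of `E₂γ₂` — ★ p855331 ∕ ★ p847070 at a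
√π-type place, ★ p855231 ∕ ★ p855177 at a √u-type place (§2).  (A `γ₂` in the vertex stabiliser fixes the root; the census seat supplies `hx₀` and finiteness — for a
regular elliptic `γ₂` the fixed set is a ball, ★ p855257.)

* §1 `latticeTree_adj_isSelfDual_iff_not` (the colouring «self-dual ∕ modular» is proper), **`ncard_fixedEdges_add_one_eq_ncard_setOf_glVertexAct_eq`**.
* §2 (torus form, any residue characteristic) **`pred_card_mul_ncard_fixedEdges_succ_add_two_of_inert_torusForm`** (`(q − 1)·(#{fixed edges} + 1) + 2 = (q + 1)·qⁿ`),
  **`pred_card_mul_ncard_fixedEdges_succ_add_two_of_eisenstein_torusForm`** (`(q − 1)·(#{fixed edges} + 1) + 2 = 2·q^{n+1}`) — ★ p855257's vertex balls through §1.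
* §3 **`natCard_fixedBy_cmLocalIntegralLevel_add_one_eq_natCard_fixedBy_modular_of_v_eq_exp_neg_one`** (√π: `#Fix(U₂⧸K₂) + 1 = #Fix(U₂⧸K♯)`),
  **`natCard_fixedBy_modular_add_one_eq_natCard_fixedBy_cmLocalIntegralLevel_of_v_eq_one`** (√u: `#Fix(U₂⧸K♯) + 1 = #Fix(U₂⧸K₂)`).

## References
* [Kottwitz1988] R. E. Kottwitz, *Tamagawa numbers*, Ann. of Math. 127 (1988), §2 (the fixed points of an elliptic element form a subtree; Euler–Poincaré).
* [Serre1980Trees] J.-P. Serre, *Trees* (1980), Ch. I §6.1 (fixed points, no inversions), Ch. II §1.1–§1.3 (the tree of `SL₂`).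
* [Tits1979] J. Tits, *Reductive groups over local fields*, PSPM 33.1 (1979), §2.7 p. 48, §3.2 p. 50.
* [LabesseLanglands1979] J.-P. Labesse, R. P. Langlands, *L-indistinguishability for SL(2)*, Canad. J. Math. 31 (1979), §2 p. 8 (elliptic tori of `GL₂`∕`SL₂` in torus form).
* [Serre1979] J.-P. Serre, *Local Fields*, GTM 67 (1979), Ch. I §6 (Eisenstein equations and totally ramified extensions).
-/

set_option autoImplicit false

noncomputable section

open scoped WithZero ValuativeRel Matrix MatrixGroups
open Matrix WithZero ValuativeRel NumberField IsDedekindDomain MulAction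

/-! ## §1 The tree of `SL₂(F)`: elements fixing a vertex -/

namespace Literature.NumberTheory.Automorphic.HermitianLatticeTree

open Literature.Combinatorics.SimpleGraph.TreeAutomorphism

section Tree

variable {F : Type*} [Field F] [ValuativeRel F] {ϖ : F} (hϖ : IsUniformizingElement ϖ) [IsDiscreteValuationRing 𝒪[F]]

omit [IsDiscreteValuationRing 𝒪[F]] in
include hϖ in
/-- **THE VERTEX COLOURING «self-dual ∕ modular» OF THE TREE OF `SL₂(F)` IS PROPER**: adjacent vertices have opposite colours (★ `latticeTree_adj_iff`, ★
`not_isModularLattice_of_isSelfDualLattice`). [cite: Serre1980Trees, Ch. II §1.1] -/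
theorem latticeTree_adj_isSelfDual_iff_not
    {M N : {M : Submodule 𝒪[F] (Fin 2 → F) // IsSpecialLattice (RingHom.id F) ϖ !![(0 : F), 1; -1, 0] M}}
    (h : (latticeTree (RingHom.id F) ϖ !![(0 : F), 1; -1, 0]).Adj M N) :
    IsSelfDualLattice (RingHom.id F) !![(0 : F), 1; -1, 0] M.1 ↔ ¬ IsSelfDualLattice (RingHom.id F) !![(0 : F), 1; -1, 0] N.1 := by
  rw [latticeTree_adj_iff] at h
  obtain ⟨-, hMN | hNM⟩ := h
  · exact ⟨fun _ hN => not_isModularLattice_of_isSelfDualLattice (RingHom.id F) (fun _ => rfl) hϖ _ hN hMN.2.1, fun _ => hMN.1⟩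
  · exact ⟨fun hM _ => not_isModularLattice_of_isSelfDualLattice (RingHom.id F) (fun _ => rfl) hϖ _ hM hNM.2.1, fun hN => absurd hNM.1 hN⟩

include hϖ in
/-- **THE FIXED SUBTREE COUNT ON THE TREE OF `SL₂(F)`**: for ANY `g ∈ GL₂(F)` fixing a vertex `x₀`, with finitely many fixed vertices,
`#{e ∈ E(X) | g·e = e set-wise} + 1 = #{x | g·x = x}` (`Set.ncard`) — no determinant ∕ type hypothesis (a vertex-fixing `g` preserves the bipartition, hence inverts no edge).
The generic fixed-subtree count `ncard_fixedEdges_add_one_eq_ncard_fixedVerts_of_isTree` over ★ `isTree_latticeTree_id_altJ`, ★ `latticeTree_adj_glVertexAct`, ★ `glVertexAct_injective`.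
[cite: Kottwitz1988, §2] [cite: Serre1980Trees, Ch. I §6.1; Ch. II §1.1] -/
theorem ncard_fixedEdges_add_one_eq_ncard_setOf_glVertexAct_eq (g : GL (Fin 2) F)
    {x₀ : {M : Submodule 𝒪[F] (Fin 2 → F) // IsSpecialLattice (RingHom.id F) ϖ !![(0 : F), 1; -1, 0] M}} (hx₀ : glVertexAct hϖ g x₀ = x₀)
    (hfin : {x : {M : Submodule 𝒪[F] (Fin 2 → F) // IsSpecialLattice (RingHom.id F) ϖ !![(0 : F), 1; -1, 0] M} | glVertexAct hϖ g x = x}.Finite) :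
    {e : (latticeTree (RingHom.id F) ϖ !![(0 : F), 1; -1, 0]).edgeSet |
        Sym2.map (glVertexAct hϖ g) (e : Sym2 {M : Submodule 𝒪[F] (Fin 2 → F) // IsSpecialLattice (RingHom.id F) ϖ !![(0 : F), 1; -1, 0] M}) = e}.ncard + 1 =
      {x : {M : Submodule 𝒪[F] (Fin 2 → F) // IsSpecialLattice (RingHom.id F) ϖ !![(0 : F), 1; -1, 0] M} | glVertexAct hϖ g x = x}.ncard := by
  -- `g` as an injective graph endomorphism of the tree
  let φ : (latticeTree (RingHom.id F) ϖ !![(0 : F), 1; -1, 0]) →g (latticeTree (RingHom.id F) ϖ !![(0 : F), 1; -1, 0]) :=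
    ⟨glVertexAct hϖ g, fun h => latticeTree_adj_glVertexAct hϖ g h⟩
  have hφ : (φ : {M : Submodule 𝒪[F] (Fin 2 → F) // IsSpecialLattice (RingHom.id F) ϖ !![(0 : F), 1; -1, 0] M} → _) = glVertexAct hϖ g := rfl
  have h := ncard_fixedEdges_add_one_eq_ncard_fixedVerts_of_isTree (isTree_latticeTree_id_altJ hϖ) φ (by rw [hφ]; exact glVertexAct_injective hϖ g)
    (x₀ := x₀) (by rw [hφ]; exact hx₀) (by rw [hφ]; exact hfin)
  rw [hφ] at h
  exact h

/-! ## §2 Torus form: the number of set-wise fixed EDGES of a regular elliptic element (any residue characteristic) -/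

include hϖ in
/-- **THE FIXED EDGES OF AN ELLIPTIC ELEMENT WITH INERT EIGEN-ORDER, TORUS-FORM TOKENS (any residue characteristic)**: in the setting of ★ p855257
`ncard_setOf_glVertexAct_eq_self_of_inert_torusForm` (`(u, v)` an inert datum, `h g h⁻¹ = c·γ₁`, `γ₁ = (a, bv; b, a + bu)`, `a b ∈ 𝒪`, `|det γ₁| = 1`, `c ≠ 0`, `|b| = |ϖ|ⁿ`),
**`(q − 1)·(#{e | g·e = e set-wise} + 1) + 2 = (q + 1)·qⁿ`** — the vertex ball count forces a nonempty finite fixed vertex set (`q ≥ 2`), and §1 trades vertices for edges `+ 1`.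
[cite: Kottwitz1988, §2] [cite: LabesseLanglands1979, §2 p. 8] [cite: Serre1980Trees, Ch. I §6.1; Ch. II §1.1] -/
theorem pred_card_mul_ncard_fixedEdges_succ_add_two_of_inert_torusForm [Finite (IsLocalRing.ResidueField 𝒪[F])] {u v : F} (hu : u ∈ 𝒪[F]) (hv : v ∈ 𝒪[F])
    (hanis : ∀ c e : F, c ∈ 𝒪[F] → e ∈ 𝒪[F] → valuation F (c ^ 2 + c * e * u - e ^ 2 * v) < 1 → valuation F c < 1 ∧ valuation F e < 1)
    {g h γ₁ : GL (Fin 2) F} {c a b : F} (hc : c ≠ 0)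
    (hconj : ((h * g * h⁻¹ : GL (Fin 2) F) : Matrix (Fin 2) (Fin 2) F) = c • (γ₁ : Matrix (Fin 2) (Fin 2) F))
    (hγ₁ : (γ₁ : Matrix (Fin 2) (Fin 2) F) = !![a, b * v; b, a + b * u]) (ha : a ∈ 𝒪[F]) (hb : b ∈ 𝒪[F])
    (hγ₁det : valuation F (γ₁ : Matrix (Fin 2) (Fin 2) F).det = 1) {n : ℕ} (hbn : valuation F b = valuation F ϖ ^ n)
    (v₀ : {M : Submodule 𝒪[F] (Fin 2 → F) // IsSpecialLattice (RingHom.id F) ϖ !![(0 : F), 1; -1, 0] M}) (hv₀ : v₀.1 = latt (1 : Matrix (Fin 2) (Fin 2) F)) :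
    (Nat.card (IsLocalRing.ResidueField 𝒪[F]) - 1) *
        ({e : (latticeTree (RingHom.id F) ϖ !![(0 : F), 1; -1, 0]).edgeSet |
          Sym2.map (glVertexAct hϖ g) (e : Sym2 {M : Submodule 𝒪[F] (Fin 2 → F) // IsSpecialLattice (RingHom.id F) ϖ !![(0 : F), 1; -1, 0] M}) = e}.ncard + 1) + 2 =
      (Nat.card (IsLocalRing.ResidueField 𝒪[F]) + 1) * Nat.card (IsLocalRing.ResidueField 𝒪[F]) ^ n := by
  have hV := ncard_setOf_glVertexAct_eq_self_of_inert_torusForm hϖ hu hv hanis hc hconj hγ₁ ha hb hγ₁det hbn v₀ hv₀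
  -- the fixed vertex set is nonempty and finite: `2 < (q + 1)·qⁿ`
  have hq : 1 < Nat.card (IsLocalRing.ResidueField 𝒪[F]) := Finite.one_lt_card
  have hpow : 1 ≤ Nat.card (IsLocalRing.ResidueField 𝒪[F]) ^ n := Nat.one_le_pow _ _ (by omega)
  have hne : {x : {M : Submodule 𝒪[F] (Fin 2 → F) // IsSpecialLattice (RingHom.id F) ϖ !![(0 : F), 1; -1, 0] M} | glVertexAct hϖ g x = x}.ncard ≠ 0 := by
    intro h0
    rw [h0, mul_zero, zero_add] at hV
    have h3 := Nat.mul_le_mul_left (Nat.card (IsLocalRing.ResidueField 𝒪[F]) + 1) hpow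
    omega
  obtain ⟨x₀, hx₀⟩ := Set.nonempty_of_ncard_ne_zero hne
  rw [← ncard_fixedEdges_add_one_eq_ncard_setOf_glVertexAct_eq hϖ g hx₀ (Set.finite_of_ncard_ne_zero hne)] at hV
  exact hV

include hϖ in
/-- **THE FIXED EDGES OF AN ELLIPTIC ELEMENT WITH EISENSTEIN EIGEN-ORDER, TORUS-FORM TOKENS (any residue characteristic)**: in the setting of ★ p855257
`ncard_setOf_glVertexAct_eq_self_of_eisenstein_torusForm` (`(u, v)` an Eisenstein datum `|u| < 1`, `|v| = |ϖ|`; `h g h⁻¹ = c·γ₁`, `γ₁ = (a, bv; b, a + bu)`, `a b ∈ 𝒪`,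
`|det γ₁| = 1`, `c ≠ 0`, `|b| = |ϖ|ⁿ`), **`(q − 1)·(#{e | g·e = e set-wise} + 1) + 2 = 2·q^{n+1}`** (vertex ball ★ p855257 + §1).
[cite: Kottwitz1988, §2] [cite: LabesseLanglands1979, §2 p. 8] [cite: Serre1980Trees, Ch. I §6.1; Ch. II §1.1] [cite: Serre1979, Ch. I §6] -/
theorem pred_card_mul_ncard_fixedEdges_succ_add_two_of_eisenstein_torusForm [Finite (IsLocalRing.ResidueField 𝒪[F])] {u v : F} (hu : u ∈ 𝒪[F])
    (hu1 : valuation F u < 1) (hv1 : valuation F v = valuation F ϖ)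
    {g h γ₁ : GL (Fin 2) F} {c a b : F} (hc : c ≠ 0)
    (hconj : ((h * g * h⁻¹ : GL (Fin 2) F) : Matrix (Fin 2) (Fin 2) F) = c • (γ₁ : Matrix (Fin 2) (Fin 2) F))
    (hγ₁ : (γ₁ : Matrix (Fin 2) (Fin 2) F) = !![a, b * v; b, a + b * u]) (ha : a ∈ 𝒪[F]) (hb : b ∈ 𝒪[F])
    (hγ₁det : valuation F (γ₁ : Matrix (Fin 2) (Fin 2) F).det = 1) {n : ℕ} (hbn : valuation F b = valuation F ϖ ^ n)
    (v₀ : {M : Submodule 𝒪[F] (Fin 2 → F) // IsSpecialLattice (RingHom.id F) ϖ !![(0 : F), 1; -1, 0] M}) (hv₀ : v₀.1 = latt (1 : Matrix (Fin 2) (Fin 2) F)) :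
    (Nat.card (IsLocalRing.ResidueField 𝒪[F]) - 1) *
        ({e : (latticeTree (RingHom.id F) ϖ !![(0 : F), 1; -1, 0]).edgeSet |
          Sym2.map (glVertexAct hϖ g) (e : Sym2 {M : Submodule 𝒪[F] (Fin 2 → F) // IsSpecialLattice (RingHom.id F) ϖ !![(0 : F), 1; -1, 0] M}) = e}.ncard + 1) + 2 =
      2 * Nat.card (IsLocalRing.ResidueField 𝒪[F]) ^ (n + 1) := by
  have hV := ncard_setOf_glVertexAct_eq_self_of_eisenstein_torusForm hϖ hu hu1 hv1 hc hconj hγ₁ ha hb hγ₁det hbn v₀ hv₀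
  -- the fixed vertex set is nonempty and finite: `2 < 2·q^{n+1}`
  have hq : 1 < Nat.card (IsLocalRing.ResidueField 𝒪[F]) := Finite.one_lt_card
  have hpow : Nat.card (IsLocalRing.ResidueField 𝒪[F]) ^ (n + 1) ≠ 1 := by
    rw [Ne, pow_eq_one_iff]
    omega
  have hne : {x : {M : Submodule 𝒪[F] (Fin 2 → F) // IsSpecialLattice (RingHom.id F) ϖ !![(0 : F), 1; -1, 0] M} | glVertexAct hϖ g x = x}.ncard ≠ 0 := by
    intro h0
    rw [h0, mul_zero, zero_add] at hV
    omega
  obtain ⟨x₀, hx₀⟩ := Set.nonempty_of_ncard_ne_zero hne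
  rw [← ncard_fixedEdges_add_one_eq_ncard_setOf_glVertexAct_eq hϖ g hx₀ (Set.finite_of_ncard_ne_zero hne)] at hV
  exact hV

end Tree

end Literature.NumberTheory.Automorphic.HermitianLatticeTree

/-! ## §3 The CM carrier `U₂ = U(Φ₂)(L⁺_v)` at a ramified place: `#Fix(U₂⧸K_edge) + 1 = #Fix(U₂⧸K_vertex)` -/

namespace Literature.NumberTheory.Automorphic.UnitaryGroup

open Literature.NumberTheory.Automorphic Literature.NumberTheory.Automorphic.HermitianLatticeTree Literature.GroupTheory

section Place

variable (L : Type) [Field L] [NumberField L] [IsCMField L] (v : HeightOneSpectrum (𝓞 ↥(maximalRealSubfield L)))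
  (w : PlacesOver L v) (hw : IsCMField.complexConj L • w.1 = w.1)
  {α : w.1.adicCompletion L} (hα : galAdicCompletionMap (L := L) (IsCMField.complexConj L) hw α = -α) (hα0 : α ≠ 0)
  {ϖF : v.adicCompletion ↥(maximalRealSubfield L)} (hϖF : Valued.v ϖF = exp (-1 : ℤ))

include hα hα0 in
/-- **√π-TYPE (tame or wild, no `|2|_w = 1`): `#Fix_{γ₂}(U₂ ⧸ K₂) + 1 = #Fix_{γ₂}(U₂ ⧸ K♯)`** — `w ∣ v` ramified non-split with an anti-fixed UNIFORMISER `α`, `η` any uniformiser unit,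
`C′ ≤ U₂` matched with `K♯_η`; for `γ₂ ∈ U₂` whose descent representative `g` (any one) fixes a vertex of the tree of `SL₂(L⁺_v)` and has finitely many fixed vertices (both hold
for a regular elliptic `γ₂` in a vertex stabiliser).  `K₂` ↔ set-wise fixed edges (★ p855331), `K♯` ↔ fixed vertices (★ p847070 §1 + ★ `natCard_fixedBy_eq_ncard_fixedBy_onePlace`),
and §1.  The wild replacement of ★ `natCard_fixedBy_add_one_eq_natCard_fixedBy_of_deep_of_ramified`. [cite: Kottwitz1988, §2] [cite: Serre1980Trees, Ch. I §6.1] [cite: Tits1979, §3.2 p. 50] -/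
theorem natCard_fixedBy_cmLocalIntegralLevel_add_one_eq_natCard_fixedBy_modular_of_v_eq_exp_neg_one
    (he : v.asIdeal.ramificationIdx' w.1.asIdeal ≠ 1) (hvα : Valued.v α = exp (-1 : ℤ))
    (η : (w.1.adicCompletion L)ˣ) (hη : Valued.v (η : w.1.adicCompletion L) = exp (-1 : ℤ))
    (C' : Subgroup ((cmDatum L 2 (Matrix.of fun i j : Fin 2 => if i.val + j.val + 1 = 2 then (1 : L) else 0)).Local v))
    (hC' : ∀ g', g' ∈ C' ↔ (((localNonsplitEquiv (IsCMField.complexConj L) (Matrix.of fun i j : Fin 2 => if i.val + j.val + 1 = 2 then (1 : L) else 0) (IsCMField.complexConj_ne_one L) w hw) g' : ↥(unitaryGroupOfForm (galAdicCompletionMap (L := L) (IsCMField.complexConj L) hw) (placeForm (Matrix.of fun i j : Fin 2 => if i.val + j.val + 1 = 2 then (1 : L) else 0) w.1))) : GL (Fin 2) (w.1.adicCompletion L)) ∈ (glInt 2 (w.1.adicCompletion L)).map (MulAut.conj (glDiagonal 2 (w.1.adicCompletion L) ![1, η])).toMonoidHom)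
    (γ₂ : ((cmDatum L 2 (Matrix.of fun i j : Fin 2 => if i.val + j.val + 1 = 2 then (1 : L) else 0)).Local v))
    {s : w.1.adicCompletion L} {g : GL (Fin 2) (v.adicCompletion ↥(maximalRealSubfield L))} (hs : s ≠ 0)
    (hsg : Matrix.diagonal ![1, α] * ((((localNonsplitEquiv (IsCMField.complexConj L) (Matrix.of fun i j : Fin 2 => if i.val + j.val + 1 = 2 then (1 : L) else 0) (IsCMField.complexConj_ne_one L) w hw) γ₂ : ↥(unitaryGroupOfForm (galAdicCompletionMap (L := L) (IsCMField.complexConj L) hw) (placeForm (Matrix.of fun i j : Fin 2 => if i.val + j.val + 1 = 2 then (1 : L) else 0) w.1))) : GL (Fin 2) (w.1.adicCompletion L)) : Matrix (Fin 2) (Fin 2) (w.1.adicCompletion L)) * Matrix.diagonal ![1, α⁻¹] =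
      s • (g : Matrix (Fin 2) (Fin 2) (v.adicCompletion ↥(maximalRealSubfield L))).map (toPlace v w))
    {x₀ : {M : Submodule 𝒪[v.adicCompletion ↥(maximalRealSubfield L)] (Fin 2 → v.adicCompletion ↥(maximalRealSubfield L)) //
      IsSpecialLattice (RingHom.id _) ϖF !![(0 : v.adicCompletion ↥(maximalRealSubfield L)), 1; -1, 0] M}}
    (hx₀ : glVertexAct (isUniformizingElement_of_v_eq hϖF) g x₀ = x₀)
    (hfin : {x : {M : Submodule 𝒪[v.adicCompletion ↥(maximalRealSubfield L)] (Fin 2 → v.adicCompletion ↥(maximalRealSubfield L)) //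
      IsSpecialLattice (RingHom.id _) ϖF !![(0 : v.adicCompletion ↥(maximalRealSubfield L)), 1; -1, 0] M} | glVertexAct (isUniformizingElement_of_v_eq hϖF) g x = x}.Finite) :
    Nat.card (fixedBy (((cmDatum L 2 (Matrix.of fun i j : Fin 2 => if i.val + j.val + 1 = 2 then (1 : L) else 0)).Local v) ⧸
        cmLocalIntegralLevel L 2 (Matrix.of fun i j : Fin 2 => if i.val + j.val + 1 = 2 then (1 : L) else 0) v) γ₂) + 1 =
      Nat.card (fixedBy (((cmDatum L 2 (Matrix.of fun i j : Fin 2 => if i.val + j.val + 1 = 2 then (1 : L) else 0)).Local v) ⧸ C') γ₂) := by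
  haveI : IsDiscreteValuationRing 𝒪[v.adicCompletion ↥(maximalRealSubfield L)] := isDiscreteValuationRing_integer_of_compatible hϖF
  rw [natCard_fixedBy_cmLocalIntegralLevel_eq_ncard_fixedEdges_of_v_eq_exp_neg_one L v w hw hα hα0 hϖF he hvα γ₂ hs hsg,
    natCard_fixedBy_eq_ncard_fixedBy_onePlace L v w hw η C' hC' γ₂,
    ncard_fixedBy_quotient_comap_modular_eq_ncard_setOf_glVertexAct L v w hw hα hα0 hϖF he hvα η hη _ hs hsg]
  exact ncard_fixedEdges_add_one_eq_ncard_setOf_glVertexAct_eq (isUniformizingElement_of_v_eq hϖF) g hx₀ hfin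

include hα hα0 in
/-- **√u-TYPE (wild, `d` even, no `|2|_w = 1`): `#Fix_{γ₂}(U₂ ⧸ K♯) + 1 = #Fix_{γ₂}(U₂ ⧸ K₂)`** — `w ∣ v` ramified non-split with an anti-fixed UNIT `α`, `η` any uniformiser unit,
`C′ ≤ U₂` matched with `K♯_η`; for `γ₂ ∈ U₂` whose descent representative `g` fixes a vertex and has finitely many fixed vertices.  `K♯` ↔ set-wise fixed
edges (★ p855231), `K₂` ↔ fixed vertices (★ p855177), and §1 — the dictionary of the √π case FLIPPED. [cite: Kottwitz1988, §2] [cite: Serre1980Trees, Ch. I §6.1] [cite: Tits1979, §3.2 p. 50] -/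
theorem natCard_fixedBy_modular_add_one_eq_natCard_fixedBy_cmLocalIntegralLevel_of_v_eq_one
    (he : v.asIdeal.ramificationIdx' w.1.asIdeal ≠ 1) (hvα : Valued.v α = 1)
    (η : (w.1.adicCompletion L)ˣ) (hη : Valued.v (η : w.1.adicCompletion L) = exp (-1 : ℤ))
    (C' : Subgroup ((cmDatum L 2 (Matrix.of fun i j : Fin 2 => if i.val + j.val + 1 = 2 then (1 : L) else 0)).Local v))
    (hC' : ∀ g', g' ∈ C' ↔ (((localNonsplitEquiv (IsCMField.complexConj L) (Matrix.of fun i j : Fin 2 => if i.val + j.val + 1 = 2 then (1 : L) else 0) (IsCMField.complexConj_ne_one L) w hw) g' : ↥(unitaryGroupOfForm (galAdicCompletionMap (L := L) (IsCMField.complexConj L) hw) (placeForm (Matrix.of fun i j : Fin 2 => if i.val + j.val + 1 = 2 then (1 : L) else 0) w.1))) : GL (Fin 2) (w.1.adicCompletion L)) ∈ (glInt 2 (w.1.adicCompletion L)).map (MulAut.conj (glDiagonal 2 (w.1.adicCompletion L) ![1, η])).toMonoidHom)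
    (γ₂ : ((cmDatum L 2 (Matrix.of fun i j : Fin 2 => if i.val + j.val + 1 = 2 then (1 : L) else 0)).Local v))
    {s : w.1.adicCompletion L} {g : GL (Fin 2) (v.adicCompletion ↥(maximalRealSubfield L))} (hs : s ≠ 0)
    (hsg : Matrix.diagonal ![1, α] * ((((localNonsplitEquiv (IsCMField.complexConj L) (Matrix.of fun i j : Fin 2 => if i.val + j.val + 1 = 2 then (1 : L) else 0) (IsCMField.complexConj_ne_one L) w hw) γ₂ : ↥(unitaryGroupOfForm (galAdicCompletionMap (L := L) (IsCMField.complexConj L) hw) (placeForm (Matrix.of fun i j : Fin 2 => if i.val + j.val + 1 = 2 then (1 : L) else 0) w.1))) : GL (Fin 2) (w.1.adicCompletion L)) : Matrix (Fin 2) (Fin 2) (w.1.adicCompletion L)) * Matrix.diagonal ![1, α⁻¹] =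
      s • (g : Matrix (Fin 2) (Fin 2) (v.adicCompletion ↥(maximalRealSubfield L))).map (toPlace v w))
    {x₀ : {M : Submodule 𝒪[v.adicCompletion ↥(maximalRealSubfield L)] (Fin 2 → v.adicCompletion ↥(maximalRealSubfield L)) //
      IsSpecialLattice (RingHom.id _) ϖF !![(0 : v.adicCompletion ↥(maximalRealSubfield L)), 1; -1, 0] M}}
    (hx₀ : glVertexAct (isUniformizingElement_of_v_eq hϖF) g x₀ = x₀)
    (hfin : {x : {M : Submodule 𝒪[v.adicCompletion ↥(maximalRealSubfield L)] (Fin 2 → v.adicCompletion ↥(maximalRealSubfield L)) //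
      IsSpecialLattice (RingHom.id _) ϖF !![(0 : v.adicCompletion ↥(maximalRealSubfield L)), 1; -1, 0] M} | glVertexAct (isUniformizingElement_of_v_eq hϖF) g x = x}.Finite) :
    Nat.card (fixedBy (((cmDatum L 2 (Matrix.of fun i j : Fin 2 => if i.val + j.val + 1 = 2 then (1 : L) else 0)).Local v) ⧸ C') γ₂) + 1 =
      Nat.card (fixedBy (((cmDatum L 2 (Matrix.of fun i j : Fin 2 => if i.val + j.val + 1 = 2 then (1 : L) else 0)).Local v) ⧸
        cmLocalIntegralLevel L 2 (Matrix.of fun i j : Fin 2 => if i.val + j.val + 1 = 2 then (1 : L) else 0) v) γ₂) := by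
  haveI : IsDiscreteValuationRing 𝒪[v.adicCompletion ↥(maximalRealSubfield L)] := isDiscreteValuationRing_integer_of_compatible hϖF
  rw [natCard_fixedBy_modular_eq_ncard_fixedEdges_of_v_eq_one L v w hw hα hα0 hϖF he hvα η hη C' hC' γ₂ hs hsg,
    natCard_fixedBy_cmLocalIntegralLevel_eq_ncard_setOf_glVertexAct_of_v_eq_one L v w hw hα hα0 hϖF he hvα γ₂ hs hsg]
  exact ncard_fixedEdges_add_one_eq_ncard_setOf_glVertexAct_eq (isUniformizingElement_of_v_eq hϖF) g hx₀ hfin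

end Place

end Literature.NumberTheory.Automorphic.UnitaryGroup

end
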